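import Summits.ResolutionOfSingularities.ResolutionOfSingularities.Theorems.EquisingularLiftEquisingularLiftNatPrimeHypersurfaceSOP
import Literature.AlgebraicGeometry.Resolution.RegularLocalHeights
import Mathlib
import HarnessLib

/-!
# [OURS · L1 W4.5(b) · EL♮(3)] E-NEG(1), part 3a′ (ring core, continued) — a prime of coheight `2` in a regular local threefold germ is PRINCIPAL;
# the `𝔪`-primary pair in the frame currency `R ⧸ 𝔓`, `R = 𝒪_{X₁,q}` (crux `EquisingularLiftNatThree` = stmt-ResolutionOfSingularities-20148,
# parent stmt-20038)

NOT a statement of any manuscript. Helper file of the chain res-L1-w45b (cell `res-hironaka`, rung L, slot W4.5(b)); AI-written, weaker than expert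
review; filed `--supports stmt-ResolutionOfSingularities-20148 --as helper`; it closes nothing. Object (O1) E-NEG(1) of res-L1-w45b-plan-1's
PLANNER-MEMO-g9-1, part 3a′: removes the input «`g` prime with `𝔭 = (g)`» of part 3a (…NatPrimeHypersurfaceSOP, p530215) — the equation of the
prime divisor `D♭ ⊂ E` is PRODUCED from the prime `𝔭` of the carrier germ (Auslander–Buchsbaum + the dimension formula of regular local rings), and
the headline is restated one level up, in the frame currency of the ambient stalk `R = 𝒪_{X₁,q}` (regular of dimension `4`, carrier equation `x₀`,
uniformizer `ϖ`, prime `𝔓 ⊇ (x₀)` of `D♭` with `dim R ⧸ 𝔓 = 2`), which is what part 3b's scheme plumbing meets (`𝒪_{V(D♭)_red, z} ≅ R ⧸ 𝔓`).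

CONTENT (pure commutative algebra).
* `exists_prime_span_singleton_eq_of_ringKrullDim_quotient` — `A` regular local of dimension `3`, `𝔭` prime with `dim A ⧸ 𝔭 = 2` ⟹ `𝔭 = (g)` for a
  PRIME element `g` (`ht 𝔭 = 1` by the tree's `height_add_ringKrullDim_quotient`; `𝔭 ∋` a prime `p` by Mathlib `Ideal.IsPrime.exists_mem_prime_of_ne_bot`
  in the UFD `A`; `(p) = 𝔭` by Mathlib `Ideal.height_add_one_le_of_lt_of_isPrime`).
* **`isQuasiRegular_pair_quotient_prime_of_ringKrullDim`** — part 3a's headline with `𝔭` in place of `(g)`: `A` regular local, `dim A = 3`, `ϖ ∈ 𝔪 ∖ 𝔪²`,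
  `𝔭` prime, `dim A ⧸ 𝔭 = 2`, `𝔭 ⊄ (ϖ)`, `(x̄₁, x̄₂) ⊂ A ⧸ 𝔭` with maximal radical ⟹ `![x̄₁, x̄₂]` quasi-regular.

References: H. Matsumura, *Commutative Ring Theory* (1986), §5 p. 31, Thms. 14.2, 17.4, 20.3 — through the cited tree files and Mathlib.
OURS planning text (index only): L/w45b/PLANNER-MEMO-g9-1.md v1.1 §1 (c1).
-/

set_option linter.dupNamespace false -- mandated namespace `Summit.<Summit>.<Problem>` of this single-conjunct summit

noncomputable section

open IsLocalRing Literature.AlgebraicGeometry.Resolution Literature.RingTheory.TightClosure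

namespace Summit.ResolutionOfSingularities.ResolutionOfSingularities.Cruxes.EquisingularLiftNat.Sections

universe u

variable {A : Type u} [CommRing A] [IsRegularLocalRing A]

/-- **A prime of coheight `2` in a regular local ring of dimension `3` is generated by a prime element** (height `1` by the dimension
formula; height-one primes of the factorial `A` are principal). [cite: Matsumura1987, §5 p. 31 and Thm. 20.3] [OURS · L1 W4.5b] -/
theorem exists_prime_span_singleton_eq_of_ringKrullDim_quotient (h3 : ringKrullDim A = (3 : ℕ)) (𝔭 : Ideal A) [𝔭.IsPrime]
    (h2 : ringKrullDim (A ⧸ 𝔭) = (2 : ℕ)) : ∃ g : A, Prime g ∧ 𝔭 = Ideal.span {g} := by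
  classical
  haveI : IsDomain A := isDomain_of_isRegularLocalRing A
  haveI : UniqueFactorizationMonoid A := IsRegularLocalRing.uniqueFactorizationMonoid A
  -- `ht 𝔭 = 1`
  have hht : 𝔭.height = 1 := by
    have h := height_add_ringKrullDim_quotient (S := A) 𝔭
    rw [h2, h3] at h
    have h' : ((𝔭.height : WithBot ℕ∞) + ((2 : ℕ) : WithBot ℕ∞)) = ((3 : ℕ) : WithBot ℕ∞) := h
    have hfin : 𝔭.height ≠ ⊤ := 𝔭.height_ne_top Ideal.IsPrime.ne_top'
    obtain ⟨n, hn⟩ := ENat.ne_top_iff_exists.mp hfin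
    rw [← hn] at h' ⊢
    have h'' : ((n + 2 : ℕ) : WithBot ℕ∞) = ((3 : ℕ) : WithBot ℕ∞) := by
      rw [← h']; push_cast; rfl
    have : n + 2 = 3 := by exact_mod_cast h''
    have hn1 : n = 1 := by omega
    rw [hn1]; rfl
  -- `𝔭 ≠ 0` contains a prime element `p`
  have hne : 𝔭 ≠ ⊥ := by
    intro h
    rw [h, Ideal.height_bot] at hht
    exact zero_ne_one hht
  obtain ⟨p, hp𝔭, hp⟩ := Ideal.IsPrime.exists_mem_prime_of_ne_bot inferInstance hne
  refine ⟨p, hp, ?_⟩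
  -- `(p) ≤ 𝔭` are primes of height `1` both, hence equal
  haveI hpP : (Ideal.span ({p} : Set A)).IsPrime := (Ideal.span_singleton_prime hp.ne_zero).mpr hp
  have hle : Ideal.span ({p} : Set A) ≤ 𝔭 := (Ideal.span_singleton_le_iff_mem _).mpr hp𝔭
  by_contra hneq
  have hlt : Ideal.span ({p} : Set A) < 𝔭 := lt_of_le_of_ne hle (Ne.symm hneq)
  have h1 := Ideal.height_add_one_le_of_lt_of_isPrime hlt
  have hbot : (⊥ : Ideal A) < Ideal.span {p} := bot_lt_iff_ne_bot.mpr (by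
    rw [Ne, Ideal.span_singleton_eq_bot]; exact hp.ne_zero)
  have h0 := Ideal.height_add_one_le_of_lt_of_isPrime hbot
  rw [Ideal.height_bot, zero_add] at h0
  rw [hht] at h1
  -- `1 ≤ ht (p)` and `ht (p) + 1 ≤ 1`: impossible in `ℕ∞` with `ht (p)` finite
  have hfin : (Ideal.span ({p} : Set A)).height ≠ ⊤ := (Ideal.span ({p} : Set A)).height_ne_top Ideal.IsPrime.ne_top'
  obtain ⟨n, hn⟩ := ENat.ne_top_iff_exists.mp hfin
  rw [← hn] at h0 h1
  have e0 : (1 : ℕ) ≤ n := by exact_mod_cast h0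
  have e1 : n + 1 ≤ 1 := by exact_mod_cast h1
  omega

/-- **E-NEG(1) part 3a′ — the `𝔪`-primary pair in a prime quotient of coheight `2`.** `A` regular local of dimension `3`, `ϖ ∈ 𝔪 ∖ 𝔪²`, `𝔭` a prime
with `dim A ⧸ 𝔭 = 2` and `𝔭 ⊄ (ϖ)` (the special fibre of `D♭` is a curve, not the plane), `x₁, x₂ ∈ A` whose classes in `A ⧸ 𝔭` generate an ideal of
maximal radical ⟹ `![x̄₁, x̄₂]` is quasi-regular in `A ⧸ 𝔭` (part 3a after `𝔭 = (g)`). [cite: Matsumura1987, Thm. 17.4 (iii), Thm. 16.2 (i)] [OURS · L1 W4.5b] -/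
theorem isQuasiRegular_pair_quotient_prime_of_ringKrullDim (h3 : ringKrullDim A = (3 : ℕ)) {ϖ : A} (hϖ : ϖ ∈ maximalIdeal A)
    (hϖ2 : ϖ ∉ maximalIdeal A ^ 2) (𝔭 : Ideal A) [𝔭.IsPrime] (h2 : ringKrullDim (A ⧸ 𝔭) = (2 : ℕ))
    (h𝔭ϖ : ¬ 𝔭 ≤ Ideal.span {ϖ}) (x₁ x₂ : A)
    (hrad : (Ideal.span {Ideal.Quotient.mk 𝔭 x₁, Ideal.Quotient.mk 𝔭 x₂}).radical.IsMaximal) :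
    IsQuasiRegular ![Ideal.Quotient.mk 𝔭 x₁, Ideal.Quotient.mk 𝔭 x₂] := by
  obtain ⟨g, hg, rfl⟩ := exists_prime_span_singleton_eq_of_ringKrullDim_quotient h3 𝔭 h2
  have hgϖ : g ∉ Ideal.span {ϖ} := fun h => h𝔭ϖ ((Ideal.span_singleton_le_iff_mem _).mpr h)
  exact isQuasiRegular_pair_quotient_span_prime h3 hϖ hϖ2 hg hgϖ x₁ x₂ hrad

/-! ## rev 2 (append-only): the pair in the AMBIENT-STALK currency `R ⧸ 𝔓` (`R = 𝒪_{X₁,q}` regular of dimension `4`, carrier equation `c₀`) -/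

/-- **E-NEG(1) part 3a″ — the `𝔪`-primary pair read in the ambient stalk.** `R` regular local of dimension `4` (the stalk `𝒪_{X₁,q}`), `c₀ ∈ 𝔪 ∖ 𝔪²`
(the carrier equation), `ϖ ∈ 𝔪` with `ϖ ∉ 𝔪² + (c₀)` (the uniformizer stays a regular parameter on the carrier), `𝔓 ⊇ (c₀)` a prime with
`dim R ⧸ 𝔓 = 2` (the prime of the surface `D♭ ⊆ E`) and `𝔓 ⊄ (c₀) + (ϖ)` (its special fibre is not the whole plane `E_k`), `x₁, x₂ ∈ R` whose classes in
`R ⧸ 𝔓` generate an ideal of maximal radical ⟹ `![x̄₁, x̄₂]` is quasi-regular in `R ⧸ 𝔓` (part 3a′ in `A := R ⧸ (c₀)`, transported along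
`(R ⧸ (c₀)) ⧸ 𝔓̄ ≅ R ⧸ 𝔓`). This is the shape part 3b meets: `𝒪_{V(D♭)_red, z} ≅ R ⧸ 𝔓` (`nonempty_stalkSubschemeEquiv`).
[cite: Matsumura1987, Thm. 14.2, Thm. 17.4 (iii)] [OURS · L1 W4.5b] -/
theorem isQuasiRegular_pair_quotient_prime_of_carrier {R : Type u} [CommRing R] [IsRegularLocalRing R]
    (h4 : ringKrullDim R = (4 : ℕ)) {c₀ ϖ : R} (hc₀ : c₀ ∈ maximalIdeal R) (hc₀2 : c₀ ∉ maximalIdeal R ^ 2)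
    (hϖ : ϖ ∈ maximalIdeal R) (hϖ2 : ϖ ∉ maximalIdeal R ^ 2 ⊔ Ideal.span {c₀})
    (𝔓 : Ideal R) [𝔓.IsPrime] (hc𝔓 : c₀ ∈ 𝔓) (h2 : ringKrullDim (R ⧸ 𝔓) = (2 : ℕ))
    (h𝔓 : ¬ 𝔓 ≤ Ideal.span {c₀} ⊔ Ideal.span {ϖ}) (x₁ x₂ : R)
    (hrad : (Ideal.span {Ideal.Quotient.mk 𝔓 x₁, Ideal.Quotient.mk 𝔓 x₂}).radical.IsMaximal) :
    IsQuasiRegular ![Ideal.Quotient.mk 𝔓 x₁, Ideal.Quotient.mk 𝔓 x₂] := by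
  classical
  -- the carrier germ `A = R ⧸ (c₀)`, regular local of dimension `3`
  obtain ⟨hA, hdimA⟩ := IsRegularLocalRing.quotient_span_singleton hc₀ hc₀2
  haveI := hA
  set A := R ⧸ Ideal.span {c₀} with hAdef
  set ρ := Ideal.Quotient.mk (Ideal.span {c₀}) with hρ
  have h3 : ringKrullDim A = (3 : ℕ) := by
    obtain ⟨n, hn⟩ := exists_nat_cast_eq_ringKrullDim (R := A)
    rw [hn, h4] at hdimA
    rw [hn]
    have h' : ((n + 1 : ℕ) : WithBot ℕ∞) = ((4 : ℕ) : WithBot ℕ∞) := by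
      rw [← hdimA]; push_cast; rfl
    have h'' : n + 1 = 4 := by exact_mod_cast h'
    have : n = 3 := by omega
    rw [this]
  -- `ϖ̄` is a regular parameter of `A`
  have hsurj : Function.Surjective ρ := Ideal.Quotient.mk_surjective
  have hmaxA : (maximalIdeal R).map ρ = maximalIdeal A := map_maximalIdeal_of_surjective ρ hsurj
  have hϖA : ρ ϖ ∈ maximalIdeal A := by
    rw [← hmaxA]; exact Ideal.mem_map_of_mem _ hϖ
  have hϖA2 : ρ ϖ ∉ maximalIdeal A ^ 2 := by
    intro h
    rw [← hmaxA, ← Ideal.map_pow, Ideal.mem_map_iff_of_surjective ρ hsurj] at h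
    obtain ⟨y, hy, hyϖ⟩ := h
    apply hϖ2
    have hdiff : ϖ - y ∈ Ideal.span {c₀} := by
      rw [← Ideal.Quotient.eq, ← hρ, hyϖ]
    have : ϖ = y + (ϖ - y) := by ring
    rw [this]
    exact Submodule.add_mem_sup hy hdiff
  -- the prime `𝔭 = 𝔓 ⧸ (c₀)` of `A` and `A ⧸ 𝔭 ≅ R ⧸ 𝔓`
  have hle : Ideal.span {c₀} ≤ 𝔓 := (Ideal.span_singleton_le_iff_mem _).mpr hc𝔓
  haveI h𝔭prime : (𝔓.map ρ).IsPrime :=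
    Ideal.map_isPrime_of_surjective hsurj (by rw [hρ, Ideal.mk_ker]; exact hle)
  let e : (A ⧸ 𝔓.map ρ) ≃+* R ⧸ 𝔓 := DoubleQuot.quotQuotEquivQuotOfLE hle
  have h2A : ringKrullDim (A ⧸ 𝔓.map ρ) = (2 : ℕ) := by
    rw [ringKrullDim_eq_of_ringEquiv e, h2]
  have h𝔭ϖ : ¬ 𝔓.map ρ ≤ Ideal.span {ρ ϖ} := by
    intro hsub
    apply h𝔓
    intro y hy
    have h1 : ρ y ∈ Ideal.span {ρ ϖ} := hsub (Ideal.mem_map_of_mem _ hy)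
    obtain ⟨a, ha⟩ := Ideal.mem_span_singleton'.mp h1
    obtain ⟨a, rfl⟩ := hsurj a
    have hdiff : y - a * ϖ ∈ Ideal.span {c₀} := by
      rw [← Ideal.Quotient.eq, ← hρ, map_mul, ha]
    have : y = (y - a * ϖ) + a * ϖ := by ring
    rw [this]
    exact Submodule.add_mem_sup hdiff (Ideal.mul_mem_left _ _ (Ideal.mem_span_singleton_self ϖ))
  -- the radical condition read in `A ⧸ 𝔭`
  have he₁ : e (Ideal.Quotient.mk (𝔓.map ρ) (ρ x₁)) = Ideal.Quotient.mk 𝔓 x₁ := rfl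
  have he₂ : e (Ideal.Quotient.mk (𝔓.map ρ) (ρ x₂)) = Ideal.Quotient.mk 𝔓 x₂ := rfl
  have hI : (Ideal.span {Ideal.Quotient.mk 𝔓 x₁, Ideal.Quotient.mk 𝔓 x₂}).comap e =
      Ideal.span {Ideal.Quotient.mk (𝔓.map ρ) (ρ x₁), Ideal.Quotient.mk (𝔓.map ρ) (ρ x₂)} := by
    rw [← Ideal.map_symm, Ideal.map_span, Set.image_pair]
    change Ideal.span {e.symm _, e.symm _} = _
    rw [← he₁, ← he₂, e.symm_apply_apply, e.symm_apply_apply]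
  have hradA : (Ideal.span {Ideal.Quotient.mk (𝔓.map ρ) (ρ x₁), Ideal.Quotient.mk (𝔓.map ρ) (ρ x₂)}).radical.IsMaximal := by
    rw [← hI, ← Ideal.comap_radical]
    exact Ideal.comap_isMaximal_of_surjective e e.surjective
  -- part 3a′ in `A`, transported along `e`
  have hq := isQuasiRegular_pair_quotient_prime_of_ringKrullDim h3 hϖA hϖA2 (𝔓.map ρ) h2A h𝔭ϖ (ρ x₁) (ρ x₂) hradA
  have hcomp : (e ∘ ![Ideal.Quotient.mk (𝔓.map ρ) (ρ x₁), Ideal.Quotient.mk (𝔓.map ρ) (ρ x₂)]) =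
      ![Ideal.Quotient.mk 𝔓 x₁, Ideal.Quotient.mk 𝔓 x₂] := by
    funext l
    fin_cases l
    · exact he₁
    · exact he₂
  rw [← hcomp]
  exact hq.map_ringEquiv e

end Summit.ResolutionOfSingularities.ResolutionOfSingularities.Cruxes.EquisingularLiftNat.Sections

end
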